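import Summits.RiemannHypothesis.RiemannHypothesis.Theorems.Splittings.BombieriTruncGram

/-!
# Splittings — x-wuc (xiv-a2): the mirror-pair form `⟨x, P y⟩` on `Γ_N` and the REAL SPECTRUM of every truncation `𝒦_E(Γ_N)`

Cell rh-split, seat rh-split-x-wuc g5 (brief sha16 f79c5f09d8bcb036), card `run/shared/lean/pub/rh-split/cards/SPLIT-x-wuc.md` §11
(referee rh-split-ref g3 2026-08-27T06:23:10Z: REPLAY PASS of the scratch `HOME/rh-split-x-wuc/SplitXWucG5.lean`; lead RULING #35:
cut (xiv)).  Carved VERBATIM from that scratch (file of record sha16 66b013c38c58c722); sections as numbered there.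
* §4a `pairing N x y = Σ_j x̄_j y_{tbar j}` (`⟨x, P y⟩`, Hermitian, real diagonal, `|Re pairing x x| ≤ ‖x‖²`), `tbarEquiv`, bilinearity lemmas for
  `gram`/`pairing`, `exists_unit_smul`; §14 `im_eq_zero_of_mem_roots_charpoly_truncKMat` — every characteristic root of `𝒦_E(Γ_N)` (`E ⊆ [−a,a]`)
  is real (three lines of `P·G`), `truncNegEigenvalueBoundedAway_iff_real` (the clause `μ.im = 0` in D1's `B′` is automatic).  UNCONDITIONAL.
HONEST LABEL: «SPLITTING SEARCH over kernel-typed RH-EQUIVALENCES; a splitting A ∧ B ⟹ RH is CONDITIONAL bookkeeping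
unless A and B are both proved; nothing here bears on the truth of RH.»
-/

set_option linter.dupNamespace false

noncomputable section

open scoped Classical ComplexConjugate
open Set Filter Topology Complex MeasureTheory

namespace Summit.RiemannHypothesis.RiemannHypothesis.Theorems.Splittings.BombieriTruncPairing

open Literature.NumberTheory.LFunctions Literature.NumberTheory.LFunctions.Bombieri2000
open Summit.RiemannHypothesis.RiemannHypothesis.Theses.RuelleBand
open Summit.RiemannHypothesis.RiemannHypothesis.Theorems.Splittings.BombieriTruncEigen
open Summit.RiemannHypothesis.RiemannHypothesis.Theorems.Splittings.BombieriFozNoDep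
open Summit.RiemannHypothesis.RiemannHypothesis.Theorems.Splittings.BombieriTruncGram

variable {E : Set ℝ} {N : ℕ}

/-! ## §4 (K2) The screening criterion: a cheap test vector forces an eigenvalue in `(−c, 0)` -/

/-- The `P`-pairing `Σ_γ x̄_γ y_{γ̄}` (on the diagonal: `Σ_on |x_γ|² + 2 Σ_pairs Re(x̄_γ x_{γ̄})`, real). -/
def pairing (N : ℕ) (x y : truncIdx N → ℂ) : ℂ := ∑ j : truncIdx N, conj (x j) * y (tbar j)

/-- `bar` on `Γ_N` as a permutation. -/
def tbarEquiv (N : ℕ) : truncIdx N ≃ truncIdx N := ⟨tbar, tbar, tbar_tbar, tbar_tbar⟩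

/-- `Σ_j ‖x (tbar j)‖² = Σ_j ‖x j‖²` (`tbar` is a bijection). -/
theorem sum_norm_sq_tbar (x : truncIdx N → ℂ) : ∑ j, ‖x (tbar j)‖ ^ 2 = ∑ j, ‖x j‖ ^ 2 :=
  (tbarEquiv N).sum_comp (fun j ↦ ‖x j‖ ^ 2)

/-- Hermitian symmetry of the pairing: `conj (pairing y x) = pairing x y`. -/
theorem conj_pairing (x y : truncIdx N → ℂ) : conj (pairing N y x) = pairing N x y := by
  simp only [pairing, map_sum, map_mul, Complex.conj_conj]
  exact Fintype.sum_equiv (tbarEquiv N) _ _ fun j ↦ by simp [tbarEquiv, tbar_tbar, mul_comm]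

/-- The diagonal pairing value is real. -/
theorem pairing_self_im (x : truncIdx N → ℂ) : (pairing N x x).im = 0 :=
  Complex.conj_eq_iff_im.1 (conj_pairing x x)

/-- `|Re pairing(x,x)| ≤ Σ_j ‖x j‖²`. -/
theorem abs_pairing_self_re_le (x : truncIdx N → ℂ) : |(pairing N x x).re| ≤ ∑ j, ‖x j‖ ^ 2 := by
  rw [pairing, Complex.re_sum]
  refine (Finset.abs_sum_le_sum_abs _ _).trans ?_
  have hpt : ∀ j, |(conj (x j) * x (tbar j)).re| ≤ (‖x j‖ ^ 2 + ‖x (tbar j)‖ ^ 2) / 2 := by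
    intro j
    have h1 : |(conj (x j) * x (tbar j)).re| ≤ ‖x j‖ * ‖x (tbar j)‖ := by
      calc |(conj (x j) * x (tbar j)).re| ≤ ‖conj (x j) * x (tbar j)‖ := Complex.abs_re_le_norm _
        _ = ‖x j‖ * ‖x (tbar j)‖ := by rw [norm_mul, Complex.norm_conj]
    have h2 : 2 * ‖x j‖ * ‖x (tbar j)‖ ≤ ‖x j‖ ^ 2 + ‖x (tbar j)‖ ^ 2 := two_mul_le_add_sq _ _
    linarith
  refine (Finset.sum_le_sum fun j _ ↦ hpt j).trans (le_of_eq ?_)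
  rw [← Finset.sum_div, Finset.sum_add_distrib, sum_norm_sq_tbar x]
  ring

/-- Additivity of `gram` in the first slot. -/
theorem gram_add_left (x y z : truncIdx N → ℂ) : gram E N (x + y) z = gram E N x z + gram E N y z := by
  simp only [gram, Pi.add_apply, map_add, add_mul, Finset.sum_add_distrib]

/-- Additivity of `gram` in the second slot. -/
theorem gram_add_right (x y z : truncIdx N → ℂ) : gram E N x (y + z) = gram E N x y + gram E N x z := by
  simp only [gram, Pi.add_apply, mul_add, add_mul, Finset.sum_add_distrib]

/-- Conjugate-linearity of `gram` in the first slot. -/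
theorem gram_smul_left (κ : ℂ) (x y : truncIdx N → ℂ) : gram E N (κ • x) y = conj κ * gram E N x y := by
  simp only [gram, Pi.smul_apply, smul_eq_mul, map_mul, Finset.mul_sum]
  exact Finset.sum_congr rfl fun j _ ↦ Finset.sum_congr rfl fun l _ ↦ by ring

/-- Linearity of `gram` in the second slot. -/
theorem gram_smul_right (κ : ℂ) (x y : truncIdx N → ℂ) : gram E N x (κ • y) = κ * gram E N x y := by
  simp only [gram, Pi.smul_apply, smul_eq_mul, Finset.mul_sum]
  exact Finset.sum_congr rfl fun j _ ↦ Finset.sum_congr rfl fun l _ ↦ by ring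

/-- Additivity of `pairing` in the first slot. -/
theorem pairing_add_left (x y z : truncIdx N → ℂ) : pairing N (x + y) z = pairing N x z + pairing N y z := by
  simp only [pairing, Pi.add_apply, map_add, add_mul, Finset.sum_add_distrib]

/-- Additivity of `pairing` in the second slot. -/
theorem pairing_add_right (x y z : truncIdx N → ℂ) : pairing N x (y + z) = pairing N x y + pairing N x z := by
  simp only [pairing, Pi.add_apply, mul_add, Finset.sum_add_distrib]

/-- Conjugate-linearity of `pairing` in the first slot. -/
theorem pairing_smul_left (κ : ℂ) (x y : truncIdx N → ℂ) : pairing N (κ • x) y = conj κ * pairing N x y := by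
  simp only [pairing, Pi.smul_apply, smul_eq_mul, map_mul, Finset.mul_sum]
  exact Finset.sum_congr rfl fun j _ ↦ by ring

/-- Linearity of `pairing` in the second slot. -/
theorem pairing_smul_right (κ : ℂ) (x y : truncIdx N → ℂ) : pairing N x (κ • y) = κ * pairing N x y := by
  simp only [pairing, Pi.smul_apply, smul_eq_mul, Finset.mul_sum]
  exact Finset.sum_congr rfl fun j _ ↦ by ring

/-- Real scaling: `gram(r x, r x) = r² gram(x, x)`. -/
theorem gram_real_smul (r : ℝ) (x : truncIdx N → ℂ) :
    gram E N ((r : ℂ) • x) ((r : ℂ) • x) = ((r ^ 2 : ℝ) : ℂ) * gram E N x x := by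
  rw [gram_smul_left, gram_smul_right, Complex.conj_ofReal]; push_cast; ring

/-- Real scaling: `pairing(r x, r x) = r² pairing(x, x)`. -/
theorem pairing_real_smul (r : ℝ) (x : truncIdx N → ℂ) :
    pairing N ((r : ℂ) • x) ((r : ℂ) • x) = ((r ^ 2 : ℝ) : ℂ) * pairing N x x := by
  rw [pairing_smul_left, pairing_smul_right, Complex.conj_ofReal]; push_cast; ring

/-- `gram 0 y = 0`. -/
@[simp] theorem gram_zero_left (y : truncIdx N → ℂ) : gram E N 0 y = 0 := by simp [gram]

/-- `pairing 0 y = 0`. -/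
@[simp] theorem pairing_zero_left (y : truncIdx N → ℂ) : pairing N 0 y = 0 := by simp [pairing]

/-- `F N 0 = 0`. -/
@[simp] theorem F_zero (u : ℝ) : F N 0 u = 0 := by simp [F]

/-- Normalisation to the unit sphere by a positive real scalar. -/
theorem exists_unit_smul {x : truncIdx N → ℂ} (hx : x ≠ 0) :
    ∃ r : ℝ, 0 < r ∧ ∑ j, ‖((r : ℂ) • x) j‖ ^ 2 = 1 := by
  obtain ⟨i₀, hi₀⟩ : ∃ i, x i ≠ 0 := by
    by_contra h
    push Not at h
    exact hx (funext h)
  set s : ℝ := ∑ i, ‖x i‖ ^ 2 with hs_def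
  have hs : 0 < s := by
    have h1 : ‖x i₀‖ ^ 2 ≤ s :=
      Finset.single_le_sum (f := fun i ↦ ‖x i‖ ^ 2) (fun i _ ↦ by positivity) (Finset.mem_univ i₀)
    have h2 : 0 < ‖x i₀‖ ^ 2 := pow_pos (norm_pos_iff.2 hi₀) 2
    linarith
  refine ⟨(Real.sqrt s)⁻¹, inv_pos.2 (Real.sqrt_pos.2 hs), ?_⟩
  have hsq : ∀ i, ‖((((Real.sqrt s)⁻¹ : ℝ) : ℂ) • x) i‖ ^ 2 = s⁻¹ * ‖x i‖ ^ 2 := by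
    intro i
    rw [Pi.smul_apply, smul_eq_mul, norm_mul, Complex.norm_real,
      Real.norm_of_nonneg (inv_nonneg.2 (Real.sqrt_nonneg s)), mul_pow, inv_pow, Real.sq_sqrt hs.le]
  simp_rw [hsq, ← Finset.mul_sum]
  exact inv_mul_cancel₀ hs.ne'

/-! ## §14 The spectrum of every truncation `𝒦_E(Γ_N)` (`E ⊆ [−a,a]`) is REAL — the clause `μ.im = 0` in D1's
`TruncNegEigenvalueBoundedAway` is automatic. From `𝒦 = P·G`: `⟨v,Gv⟩ = μ⟨v,Pv⟩` with both pairings real; if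
`⟨v,Pv⟩ = 0` then `‖F_v‖²_{L²(E)} = 0`, so `G v = 0` and `μ·⟨Pv, Pv⟩ = 0`, i.e. `μ = 0`. [new-in-kernel] -/

/-- Zero Gram energy forces `F N v = 0` a.e. on `E`. -/
theorem F_ae_zero_of_gram_self_re_eq_zero {a : ℝ} (hE : E ⊆ Icc (-a) a) {v : truncIdx N → ℂ}
    (h : (gram E N v v).re = 0) : ∀ᵐ u ∂(volume.restrict E), F N v u = 0 := by
  rw [gram_self_re hE] at h
  have hint : IntegrableOn (fun u ↦ ‖F N v u‖ ^ 2) E :=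
    (Continuous.integrableOn_Icc (((continuous_F v).norm).pow 2)).mono_set hE
  have hae := (integral_eq_zero_iff_of_nonneg_ae (Eventually.of_forall fun u ↦ by positivity) hint).1 h
  filter_upwards [hae] with u hu
  simpa using hu

/-- If `F N v = 0` a.e. on `E` then `gram x v = 0` for every `x`. -/
theorem gram_eq_zero_of_F_ae_zero {a : ℝ} (hE : E ⊆ Icc (-a) a) {v : truncIdx N → ℂ}
    (h : ∀ᵐ u ∂(volume.restrict E), F N v u = 0) (x : truncIdx N → ℂ) : gram E N x v = 0 := by
  rw [gram_eq_integral hE]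
  refine integral_eq_zero_of_ae ?_
  filter_upwards [h] with u hu
  simp [hu]

/-- **Every characteristic root of `𝒦_E(Γ_N)` is real** (bounded window). [new-in-kernel] -/
theorem im_eq_zero_of_mem_roots_charpoly_truncKMat {a : ℝ} (hE : E ⊆ Icc (-a) a) {μ : ℂ}
    (hμ : μ ∈ (truncKMat E N).charpoly.roots) : μ.im = 0 := by
  obtain ⟨v, hv0, hv⟩ := Literature.Analysis.InnerProduct.exists_mulVec_eq_smul_of_mem_roots_charpoly hμ
  have h1 : gram E N v v = μ * pairing N v v := gram_eigvec hv v
  by_cases hp : pairing N v v = 0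
  · have hg : (gram E N v v).re = 0 := by rw [h1, hp, mul_zero, Complex.zero_re]
    have hae := F_ae_zero_of_gram_self_re_eq_zero hE hg
    have h2 : gram E N (fun j ↦ v (tbar j)) v = μ * pairing N (fun j ↦ v (tbar j)) v := gram_eigvec hv _
    rw [gram_eq_zero_of_F_ae_zero hE hae] at h2
    have hpx : pairing N (fun j ↦ v (tbar j)) v = ((∑ i, ‖v i‖ ^ 2 : ℝ) : ℂ) := by
      simp only [pairing]
      rw [← sum_norm_sq_tbar v]
      push_cast
      exact Finset.sum_congr rfl fun j _ ↦ by rw [RCLike.conj_mul]; norm_cast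
    obtain ⟨i₀, hi₀⟩ : ∃ i, v i ≠ 0 := by
      by_contra h
      push Not at h
      exact hv0 (funext h)
    have hpos : 0 < ∑ i, ‖v i‖ ^ 2 :=
      lt_of_lt_of_le (by positivity : 0 < ‖v i₀‖ ^ 2)
        (Finset.single_le_sum (f := fun i ↦ ‖v i‖ ^ 2) (fun i _ ↦ by positivity) (Finset.mem_univ i₀))
    rw [hpx] at h2
    have hμ0 : μ = 0 := by
      have := h2.symm
      rcases mul_eq_zero.1 this with h | h
      · exact h
      · exact absurd (by exact_mod_cast h : ∑ i, ‖v i‖ ^ 2 = 0) hpos.ne'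
    rw [hμ0, Complex.zero_im]
  · have him := congrArg Complex.im h1
    rw [gram_self_eq hE, Complex.ofReal_im, Complex.mul_im, pairing_self_im, mul_zero, zero_add] at him
    have hre : (pairing N v v).re ≠ 0 := fun h ↦ hp (Complex.ext (by simpa using h) (by simp [pairing_self_im]))
    exact (mul_eq_zero.1 him.symm).resolve_right hre

/-- Hence D1's `B′(E)` on a bounded window reads: eventually every root with negative real part is `≤ −c`. -/
theorem truncNegEigenvalueBoundedAway_iff_real {a : ℝ} (hE : E ⊆ Icc (-a) a) :
    TruncNegEigenvalueBoundedAway E ↔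
      ∃ c : ℝ, 0 < c ∧ ∃ N₀ : ℕ, ∀ N ≥ N₀, ∀ μ ∈ (truncKMat E N).charpoly.roots, μ.re < 0 → μ.re ≤ -c := by
  constructor
  · rintro ⟨c, hc, N₀, h⟩
    exact ⟨c, hc, N₀, fun N hN μ hμ hneg ↦ h N hN μ hμ (im_eq_zero_of_mem_roots_charpoly_truncKMat hE hμ) hneg⟩
  · rintro ⟨c, hc, N₀, h⟩
    exact ⟨c, hc, N₀, fun N hN μ hμ _ hneg ↦ h N hN μ hμ hneg⟩

end Summit.RiemannHypothesis.RiemannHypothesis.Theorems.Splittings.BombieriTruncPairing
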